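import Mathlib.Algebra.MvPolynomial.Funext
import Mathlib.RingTheory.KrullDimension.Field
import Mathlib.RingTheory.KrullDimension.Polynomial
import Literature.NumberTheory.Transcendental.ExpVarieties
import HarnessLib

/-!
# Generic points avoid proper subvarieties; the matrix action is multiplicative and preserves the graph of `exp`

Topic `NumberTheory/Transcendental`, namespace `Literature`. Sibling proof file of `ExpVarieties.lean`
(which stays untouched); it DISCHARGES the named facts `Literature.NumberTheory.Transcendental.IsGenericOver.not_mem_of_ssubset`,
`Literature.NumberTheory.Transcendental.matrixAct_mul` (section `MatrixActMul`, `matrixAct_mul_holds`, see there) and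
`Literature.NumberTheory.Transcendental.matrixAct_mem_expGraph` (section `MatrixActExpGraph`,
`matrixAct_mem_expGraph_holds`, see there) of that file:

* `Literature.IsGenericOver.not_mem_of_ssubset_holds : IsGenericOver.not_mem_of_ssubset` — if `z` is a
  generic point of `V ⊆ K^ι` over the subfield `F ≤ K` (`Literature.IsGenericOver F V z`: `z ∈ V` and
  the polynomials over `F` vanishing at `z` are exactly those vanishing on `V`) and `W ⊂ V` is a
  proper subset defined over `F` (`Literature.IsDefinedOver F W`: `W = Z_K(I)` for an ideal
  `I ⊆ F[X_ι]`), then `z ∉ W`.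

Proof (the standard passage from the algebraic definition of a generic point to the geometric
one).  Suppose `z ∈ W = Z_K(I)`.  Then every `p ∈ I` vanishes at `z`, i.e. `I ≤ I_F({z})`
(one direction of the Galois connection between `Z_K` and `I_F`,
`MvPolynomial.le_zeroLocus_iff_le_vanishingIdeal`); by genericity `I_F({z}) = I_F(V)`, so every
`p ∈ I` vanishes on `V`, i.e. `V ⊆ Z_K(I) = W` (the other direction), contradicting `W ⊂ V`.
Neither irreducibility nor Zariski-closedness of `V` is used, exactly as in the vendored
statement.

Sources.  The fact is vendored with the cite Marker, *A remark on Zilber's pseudoexponentiation*,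
J. Symbolic Logic 71 (2006), §1 (generic points of varieties over subfields in the statement of
Zilber's axioms; also Zilber 2005, §3) — not held here at the time of writing.  The algebraic
definition of a generic point over a ground field `K` ("(i) `ξ` lies on `V`, and (ii) any form
over `K` vanishing at `ξ` vanishes on `V`") is Hodge–Pedoe, *Methods of Algebraic Geometry* II,
Ch. X §3, and the topological reading (a generic point of a closed set `A` is an `x` with
`A = cl {x}`, so it lies in no proper closed subset) is Kunz, *Introduction to Commutative Algebra
and Algebraic Geometry*, Ch. I, Def. 4.7; the two-line argument above is the link between them.

## Discharge of `matrixAct_mem_expGraph`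

`matrixAct_mem_expGraph_holds`: the graph of exponentiation
`expGraph K n = {(x, y) ∈ Kⁿ × Kⁿ | ∀ i, yᵢ = exp xᵢ}` is stable under `matrixAct M` for every
`M ∈ Mₙ(ℤ)`.  If `yⱼ = exp xⱼ` for all `j`, then for each `i`,
`∏ⱼ yⱼ ^ M i j = ∏ⱼ (exp xⱼ) ^ M i j = ∏ⱼ exp (M i j • xⱼ) = exp (∑ⱼ M i j · xⱼ)`, because
`exp : (K, +) → (Kˣ, ·)` is a group homomorphism (the E-ring axioms `exp_zero`, `exp_add` of
`Literature.ModelTheory.ExponentialFields.ExponentialRing`, van den Dries 1984), hence commutes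
with `ℤ`-multiples/powers and with finite sums/products; in Lean `exp` is packaged as the monoid
homomorphism `(expMonoidHom K).toHomUnits : Multiplicative K →* Kˣ` and Mathlib's `map_prod`,
`map_zpow` do the rest.  This is exactly why `Mₙ(ℤ)` acts on `Gₙ(K) = Kⁿ × (Kˣ)ⁿ` compatibly
with `ex` (Zilber 2005, §2: `[M] : Gₙ → Gₙ`; §1: `ex` is a homomorphism `(F, +) → (Fˣ, ·)`), and
it is Kirby's remark (note on the axioms, §2.3) quoted in section `MatrixActMul`, together with
his axiom 1 (`exp` is a homomorphism from the additive to the multiplicative group).  The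
original paper is paywalled and not held at the time of writing; the statement discharged is the
vendored one, unchanged — an identity valid in every exponential field (no surjectivity, kernel
or Schanuel hypothesis enters).

## Discharge of `zariskiDim_univ` (dimension of affine space over an infinite field)

Section `ZariskiDimUniv` at the end of the file:

* `Literature.NumberTheory.Transcendental.vanishingIdeal_univ_eq_bot` — over an *infinite* field
  `K` the vanishing ideal of all of `K^ι` is `⊥`: a polynomial that is the zero function on `K^ι`
  is the zero polynomial (Cox–Little–O'Shea, Ch. 1 §1 Prop. 5; Mathlib `MvPolynomial.funext`).
  Infinitude is needed: over `𝔽_q` the polynomial `X^q - X` vanishes everywhere.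
* `Literature.NumberTheory.Transcendental.zariskiDim_univ_holds : zariskiDim_univ` — hence for
  `K` infinite and `ι` finite, `zariskiDim K K^ι = dim K[X_ι] ⧸ ⊥ = dim K[X_ι] = #ι`, the last
  step being `dim K[X₁, …, Xₙ] = dim K + n = n` for the Noetherian ring `K`
  (Mathlib `MvPolynomial.ringKrullDim_of_isNoetherianRing`, `ringKrullDim_eq_zero_of_field`;
  Hartshorne, Prop. I.1.9 for the statement `dim 𝔸ⁿ = n`).  This is the normalisation
  `dim Kⁿ = n` of the dimension function used throughout Marker 2006 §1 / Zilber 2005 §1.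
  (First landed as p25636; re-landed after the concurrent whole-file proposal p25753 of this
  sibling file, which did not yet contain it.)

## References

* [Marker2006] D. Marker, A remark on Zilber's pseudoexponentiation, J. Symbolic Logic 71 (2006),
  no. 3, 791–798, §1, doi:10.2178/jsl/1154698577.
* [Zilber2005] = [Zilber2005PseudoExp] B. Zilber, Pseudo-exponentiation on algebraically closed
  fields of characteristic zero, Ann. Pure Appl. Logic 132 (2005), no. 1, 67–95, §1 (`ex` a
  homomorphism), §2 (the maps `[M] : G_n → G_n`), doi:10.1016/j.apal.2004.07.001.
* [Kirby2013Axioms] J. Kirby, A note on the axioms for Zilber's pseudo-exponential fields, Notre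
  Dame J. Formal Logic 54 (2013), 509–520, §2.3, doi:10.1215/00294527-2143844, arXiv:1006.0894.
* W. V. D. Hodge, D. Pedoe, Methods of Algebraic Geometry, vol. II, Cambridge (1952, reissued
  1994), Book III, Ch. X §3 "Generic points of an irreducible variety", p. 10.
* E. Kunz, Introduction to Commutative Algebra and Algebraic Geometry, Birkhäuser (1985), Ch. I
  §4 "The spectrum of a ring", Def. 4.7, p. 26.
* [CoxLittleOShea2007] D. A. Cox, J. Little, D. O'Shea, Ideals, Varieties, and Algorithms,
  3rd ed., Springer UTM (2007), Ch. 1 §1, Prop. 5 (a polynomial over an infinite field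
  vanishing on all of `kⁿ` is `0`).
* [Hartshorne1977] R. Hartshorne, Algebraic Geometry, GTM 52 (1977), Ch. I, Prop. 1.9
  (`dim 𝔸ⁿ = n`).
-/

open MvPolynomial

namespace Literature.NumberTheory.Transcendental

variable {K : Type*} [Field K] {ι : Type*}

/-- Discharge of `IsGenericOver.not_mem_of_ssubset`: a generic point `z` of `V` over `F` lies in
no `F`-closed set `W` with `W ⊂ V`. If `z ∈ W = Z_K(I)` with `I ⊆ F[X_ι]`, then
`I ≤ I_F({z}) = I_F(V)`, hence `V ⊆ Z_K(I) = W` by the Galois connection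
`MvPolynomial.le_zeroLocus_iff_le_vanishingIdeal`, contradicting `W ⊂ V`; neither
irreducibility nor closedness of `V` is used. This is the passage from the algebraic definition
of a generic point (Hodge–Pedoe, *Methods of Algebraic Geometry* II, Ch. X §3) to the geometric
one; Marker 2006 §1, Zilber 2005 §3. [cite: Marker2006, §1] -/
theorem IsGenericOver.not_mem_of_ssubset_holds :
    IsGenericOver.not_mem_of_ssubset (K := K) (ι := ι) := by
  intro F V W z hz hW hWV hzW
  obtain ⟨I, rfl⟩ := hW
  exact hWV.2 (le_zeroLocus_iff_le_vanishingIdeal.2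
    ((le_zeroLocus_iff_le_vanishingIdeal.1 (Set.singleton_subset_iff.2 hzW)).trans_eq hz.2))

section MatrixActMul

/-! ### Discharge of `matrixAct_mul`

`M ↦ [M]` is a monoid action of `Mₙ(ℤ)` on `G_n(K) = 𝔾ₐⁿ(K) × 𝔾ₘⁿ(K)` (Zilber 2005 §2; Kirby,
*A note on the axioms for Zilber's pseudo-exponential fields*, §2.3: "each matrix `M ∈ Matₙₓₙ(ℤ)`
defines a homomorphism `Gⁿ → Gⁿ` by acting as a linear map on `𝔾ₐⁿ` and as a multiplicative map on
`𝔾ₘⁿ`"). The verification is elementary algebra: a sum swap on the additive block and, on the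
multiplicative block, `y^{a+b} = yᵃ yᵇ` (valid for `y ≠ 0`, whence the `torusLocus` hypothesis of
the vendored statement), `y^{ab} = (yᵃ)ᵇ` and a product swap. -/

variable {n : ℕ}

/-- `a ^ (∑ i ∈ s, f i) = ∏ i ∈ s, a ^ f i` for a non-zero element `a` of a field and integer
exponents (the `zpow` analogue of `Finset.prod_pow_eq_pow_sum`; needs `a ≠ 0` because of the
junk value `0⁻¹ = 0`). [folklore] -/
theorem zpow_finset_sum_of_ne_zero {a : K} (ha : a ≠ 0) {σ : Type*} (s : Finset σ) (f : σ → ℤ) :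
    a ^ (∑ i ∈ s, f i) = ∏ i ∈ s, a ^ f i := by
  classical
  induction s using Finset.induction_on with
  | empty => simp
  | insert i s hi ih => rw [Finset.sum_insert hi, Finset.prod_insert hi, zpow_add₀ ha, ih]

/-- **Discharge** of the named fact `matrixAct_mul` (Zilber 2005 §2): on the torus locus
`Kⁿ × (Kˣ)ⁿ` the action of integer matrices is multiplicative, `[M N] z = [M] ([N] z)`.
Additive block: `∑ⱼ (MN)ᵢⱼ xⱼ = ∑ⱼ Mᵢⱼ (∑ₖ Nⱼₖ xₖ)`; multiplicative block:
`∏ⱼ yⱼ ^ (MN)ᵢⱼ = ∏ⱼ (∏ₖ yₖ ^ Nⱼₖ) ^ Mᵢⱼ`, using `zpow_finset_sum_of_ne_zero` (this is where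
`z ∈ torusLocus` enters), `zpow_mul` and `Finset.prod_comm`. [cite: Zilber2005, §2] -/
theorem matrixAct_mul_holds : matrixAct_mul (K := K) (n := n) := by
  intro M N z hz
  ext (i | i)
  · simp only [matrixAct_inl, Matrix.mul_apply, Int.cast_sum, Int.cast_mul, Finset.sum_mul,
      Finset.mul_sum]
    rw [Finset.sum_comm]
    refine Finset.sum_congr rfl fun j _ => Finset.sum_congr rfl fun k _ => ?_
    ring
  · simp only [matrixAct_inr, Matrix.mul_apply]
    have hl : (∏ j, z (Sum.inr j) ^ ∑ k, M i k * N k j) =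
        ∏ j, ∏ k, z (Sum.inr j) ^ (M i k * N k j) :=
      Finset.prod_congr rfl fun j _ => zpow_finset_sum_of_ne_zero (hz j) _ _
    have hr : (∏ j, (∏ k, z (Sum.inr k) ^ N j k) ^ M i j) =
        ∏ j, ∏ k, z (Sum.inr k) ^ (N j k * M i j) :=
      Finset.prod_congr rfl fun j _ => by
        rw [← Finset.prod_zpow]
        exact Finset.prod_congr rfl fun k _ => (zpow_mul _ _ _).symm
    rw [hl, hr, Finset.prod_comm]
    exact Finset.prod_congr rfl fun j _ => Finset.prod_congr rfl fun k _ => by rw [mul_comm]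

end MatrixActMul

section MatrixActExpGraph

/-! ### Discharge of `matrixAct_mem_expGraph`

`[M]` preserves the graph of exponentiation because `exp` is a homomorphism `(K, +) → (Kˣ, ·)`
(Zilber 2005 §§1–2; Kirby, note on the axioms, §2.3 with axiom 1). -/

open Literature.ModelTheory.ExponentialFields (ExponentialRing)
open Literature.ModelTheory.ExponentialFields.ExponentialRing

variable [ExponentialRing K] {n : ℕ}

/-- **Discharge** of the named fact `matrixAct_mem_expGraph` (Zilber 2005 §2): the graph of
exponentiation `expGraph K n = {(x, y) | ∀ i, yᵢ = exp xᵢ} ⊆ Kⁿ × Kⁿ` is stable under the action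
`matrixAct M` of every integer matrix `M ∈ Mₙ(ℤ)` (additive on `x`, multiplicative on `y`): if
`yⱼ = exp xⱼ` for all `j`, then `∏ⱼ yⱼ ^ M i j = exp (∑ⱼ M i j · xⱼ)` for every `i`, because
`exp : (K, +) → (Kˣ, ·)` is a group homomorphism (`exp_zero`, `exp_add`) and so commutes with
`ℤ`-powers and finite products (`map_zpow`, `map_prod` for
`(expMonoidHom K).toHomUnits : Multiplicative K →* Kˣ`). Zilber 2005 §2 (`[M] : Gₙ(K) → Gₙ(K)` on
`Gₙ(K) = Kⁿ × (Kˣ)ⁿ`; `ex : (F, +) → (Fˣ, ·)` a homomorphism, §1); Kirby 2013 (note on the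
axioms) §2.3: "each matrix `M ∈ Matₙₓₙ(ℤ)` defines a homomorphism `Gⁿ → Gⁿ` by acting as a linear
map on `𝔾ₐⁿ` and as a multiplicative map on `𝔾ₘⁿ`". [cite: Zilber2005PseudoExp, §2] -/
theorem matrixAct_mem_expGraph_holds : matrixAct_mem_expGraph (K := K) (n := n) := by
  intro M z hz i
  rw [mem_expGraph_iff] at hz
  -- `exp` as a homomorphism into the unit group `Kˣ`, so that `map_prod` / `map_zpow` apply.
  let E : Multiplicative K →* Kˣ := (expMonoidHom K).toHomUnits
  have hE : ∀ x : K, exp x = ((E (Multiplicative.ofAdd x) : Kˣ) : K) := fun _ => rfl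
  simp only [matrixAct_inr, matrixAct_inl, hz, hE, ← zsmul_eq_mul, ofAdd_sum, ofAdd_zsmul, map_prod,
    map_zpow, Units.coe_prod, Units.val_zpow_eq_zpow_val]

end MatrixActExpGraph

section ZariskiDimUniv

/-! ### Discharge of `zariskiDim_univ`: dimension of affine space over an infinite field -/

/-- Over an infinite field `K`, the vanishing ideal of the whole affine space `K^ι` is `⊥`:
a polynomial `p ∈ K[X_ι]` with `p(x) = 0` for every `x : ι → K` is the zero polynomial
(Cox–Little–O'Shea, *Ideals, Varieties, and Algorithms*, Ch. 1 §1, Prop. 5; in Mathlib this is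
`MvPolynomial.funext`, valid over any infinite integral domain). Over a finite field this fails
(`X^q - X` on `𝔽_q`). [cite: CoxLittleOShea2007, Ch. 1 §1 Prop. 5] -/
theorem vanishingIdeal_univ_eq_bot [Infinite K] :
    MvPolynomial.vanishingIdeal K (Set.univ : Set (ι → K)) = ⊥ := by
  refine (Submodule.eq_bot_iff _).2 fun p hp => ?_
  refine MvPolynomial.funext fun x => ?_
  have hx : MvPolynomial.aeval x p = 0 := (mem_vanishingIdeal_iff.1 hp) x (Set.mem_univ x)
  rw [map_zero, ← hx]
  rfl

/-- **Discharge** of the named fact `zariskiDim_univ`: over an infinite field `K` and for a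
finite index type `ι`, affine `ι`-space has Zariski dimension `#ι`, `zariskiDim K K^ι = #ι`.
Proof: `I(K^ι) = ⊥` (`vanishingIdeal_univ_eq_bot`, which is where `Infinite K` enters), so the
coordinate ring `K[X_ι] ⧸ I(K^ι)` is `K[X_ι] ⧸ ⊥ ≃ K[X_ι]` (`RingEquiv.quotientBot`), whose Krull
dimension is `dim K + #ι = 0 + #ι` (`MvPolynomial.ringKrullDim_of_isNoetherianRing`,
`ringKrullDim_eq_zero_of_field`; Hartshorne, Prop. I.1.9). This is the normalisation
`dim Kⁿ = n` of the dimension of varieties in Marker 2006 §1. [cite: Marker2006, §1] -/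
theorem zariskiDim_univ_holds : zariskiDim_univ (K := K) (ι := ι) := by
  intro _ _
  unfold zariskiDim
  rw [ringKrullDim_eq_of_ringEquiv
      (Ideal.quotEquivOfEq (vanishingIdeal_univ_eq_bot (K := K) (ι := ι))),
    ringKrullDim_eq_of_ringEquiv (RingEquiv.quotientBot (MvPolynomial ι K)),
    MvPolynomial.ringKrullDim_of_isNoetherianRing, ringKrullDim_eq_zero_of_field, zero_add,
    Nat.card_eq_fintype_card]

end ZariskiDimUniv

end Literature.NumberTheory.Transcendental
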